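import Summits.QuantumFields.BalabanUV.Beta.EriceRemainderEnclosureHistoryAutonomyDiscrepancy
import Summits.QuantumFields.BalabanUV.Beta.EriceRemainderEnclosureHistoryAutonomyMonotoneFlat

/-!
# EriceRemainderEnclosureHistoryAutonomyMonotoneGeneral — (E43b) MONOTONE MEMORY NEVER NEEDS SMALLNESS: a functional that is NON-DECREASING
# in the history, with a zeroth moment `M` of ANY size and a floor `b > 0` on ]0,γ], has AT MOST ONE box solution of its flow with memory
# from each pin — no concavity ((E41)), no flat bottom ((E42)), no range or size restriction; hence, with (E39), EXACTLY one.  On the way,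
# for ANY zeroth-moment functional: the DOWNWARD CONTRACTION `sup_{j≥m}|D_j| ≤ (1 + (M∕2)c_{m+1}³)·sup_{j≥m+1}|D_j|` (distinct solutions NEVER
# MERGE at the level of the recursion variables: `|D_j| ≤ e^{3M∕(2b√b)}·sup_{i≥n}|D_i|` for every `n`) and the CAUCHY TAIL
# `|D_j − D_n| ≤ (M·K∕(b√b))∕√n`; so `D` is eventually SIGN-DEFINITE, and (E42)'s `eq_of_disc_tail_nonneg` finishes for monotone `B`.
# With (E38c): the threshold `3√3` is a property of OSCILLATING memory ONLY

Cell `pub-balaban`, β-function sub-cell, BINDER row D4 «RemainderConst leaves for Bałaban's split» (`HOME/BINDER-OWNERS.md`; owner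
lineage `b2b-balaban-beta-an4`; this file by co-owner #2 lineage `b2b-balaban-beta-d4-p2`, generation 40), β-FLOW TEAM duty (1),
FREEZE (0) honoured (def-free; (E43a) `…HistoryAutonomyDiscrepancy` and (E42) `…HistoryAutonomyMonotoneFlat.eq_of_disc_tail_nonneg` BY
NAME).  Seat numerics beforehand (Newton from eight starts on `b + L·u_k²`, `k = 2, 3`, `L ≤ 5000`: one solution; antitone brackets for the
convex kink `b + L·max(0, u_k − x₁)` do NOT meet — Guo's squeeze fails there, yet uniqueness holds).

HONEST FRAMING (page 1, verbatim and binding).  *"Discharging BetaPertH makes Bałaban's UV stability UNCONDITIONAL — a real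
constructive-QFT result; it is NOT the continuum limit and NOT the Clay problem."*  THIS FILE DISCHARGES NOTHING OF THE KIND.  Pure real
analysis about an ABSTRACT functional with displayed monotonicity, zeroth moment and floor; which monotonicity Bałaban's limit functional
has in the preceding couplings is NOT PRINTED ([I] p. 298 qualitative) and not asserted.  Row D4 class UNCHANGED (critical-path width 0;
instance 0∕1; D4 DISCHARGE NO DATE).  HONEST DEPENDENCY: continuum YM on T⁴ ⇐ BetaPertH ∧ nine spine estimates (0/9 proved); BetaPertH ⇐
(D1) ∧ (D4) ∧ CAP+tail; G-an2-4 gates asym, D1 and NE2/3/4.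

WHAT IS PROVED ([folklore]; 0 `def`, 0 sorry).  §4 `inv_mul_sqrt_le'`, `sum_Ico_inv_mul_sqrt_le'`, `prod_Ico_le_prod_Ico_of_one_le`,
**`abs_disc_le_mul_prod_of_tail`** (the downward contraction), `prod_le_exp`, **`abs_disc_le_C_mul_of_tail`** (non-merging),
**`abs_disc_sub_disc_le_tail`** (the Cauchy tail).  §5 **`memFlow_unique_of_monotone_zm`** (monotone + zeroth moment + floor ⟹ uniqueness,
NO further condition), `existsUnique_memFlow_of_monotone_zm` (from any existence witness, e.g. (E39) `exists_memFlow_zm`).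
-/

noncomputable section
open Filter Topology Finset

namespace Summit.QuantumFields.BalabanUV.Beta.EriceRemainderEnclosureHistoryAutonomyMonotoneGeneral

open Literature.MathematicalPhysics.QuantumFieldTheory.Balaban1983to89
open Literature.MathematicalPhysics.QuantumFieldTheory.Balaban1983to89.T4BetaStationary
open Literature.MathematicalPhysics.QuantumFieldTheory.Balaban1983to89.T4BetaFlowWellPosed
open Summit.QuantumFields.BalabanUV.Beta.EriceRemainderEnclosureHistoryAutonomyWellPosed
open Summit.QuantumFields.BalabanUV.Beta.EriceRemainderEnclosureHistoryAutonomyThreshold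
open Summit.QuantumFields.BalabanUV.Beta.EriceRemainderEnclosureHistoryAutonomyMonotoneFlat
open Summit.QuantumFields.BalabanUV.Beta.EriceRemainderEnclosureHistoryAutonomyTelescoping
open Summit.QuantumFields.BalabanUV.Beta.EriceRemainderEnclosureHistoryAutonomyDiscrepancy

variable {B : (ℕ → ℝ) → ℝ} {M γ b gIR : ℝ} {h h' : ℕ → ℝ}

/-! ## §4 The downward contraction: distinct solutions never merge at the level of the recursion variables -/

/-- One more telescoping tail, at the index needed: for `1 ≤ m`, `1∕((m+1)√(m+1)) ≤ 2(1∕√m − 1∕√(m+1))`. [folklore] -/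
theorem inv_mul_sqrt_le' {m : ℕ} (hm : 1 ≤ m) :
    1 / (((m : ℝ) + 1) * Real.sqrt ((m : ℝ) + 1)) ≤ 2 * (1 / Real.sqrt (m : ℝ) - 1 / Real.sqrt ((m : ℝ) + 1)) := by
  have hm' : (1 : ℝ) ≤ m := by exact_mod_cast hm
  set A := Real.sqrt ((m : ℝ) + 1) with hA
  set Bq := Real.sqrt (m : ℝ) with hBq
  have hA0 : 0 < A := Real.sqrt_pos.2 (by positivity)
  have hB0 : 0 < Bq := Real.sqrt_pos.2 (by linarith)
  have hBA : Bq ≤ A := Real.sqrt_le_sqrt (by linarith)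
  have hA2 : A ^ 2 = (m : ℝ) + 1 := Real.sq_sqrt (by positivity)
  have hB2 : Bq ^ 2 = (m : ℝ) := Real.sq_sqrt (by linarith)
  have hdiff : 1 ≤ 2 * A * (A - Bq) := by nlinarith
  rw [← hA2, show 2 * (1 / Bq - 1 / A) = 2 * (A - Bq) / (A * Bq) by field_simp,
    div_le_div_iff₀ (by positivity) (by positivity), one_mul]
  calc A * Bq ≤ A * A := mul_le_mul_of_nonneg_left hBA hA0.le
    _ = 1 * (A * A) := by ring
    _ ≤ (2 * A * (A - Bq)) * (A * A) := mul_le_mul_of_nonneg_right hdiff (by positivity)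
    _ = 2 * (A - Bq) * (A ^ 2 * A) := by ring

/-- TAIL at the index needed: for `1 ≤ n`, `Σ_{l ∈ [n, N)} 1∕((l+1)√(l+1)) ≤ 2∕√n`. [folklore] -/
theorem sum_Ico_inv_mul_sqrt_le' {n : ℕ} (hn : 1 ≤ n) (N : ℕ) :
    ∑ l ∈ Ico n N, 1 / (((l : ℝ) + 1) * Real.sqrt ((l : ℝ) + 1)) ≤ 2 / Real.sqrt (n : ℝ) := by
  rcases le_or_gt N n with hNn | hnN
  · rw [Ico_eq_empty (by omega), sum_empty]; positivity
  · have key : ∀ N, n ≤ N → ∑ l ∈ Ico n N, 1 / (((l : ℝ) + 1) * Real.sqrt ((l : ℝ) + 1))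
        ≤ 2 * (1 / Real.sqrt (n : ℝ) - 1 / Real.sqrt (N : ℝ)) := by
      intro N hN
      induction N, hN using Nat.le_induction with
      | base => simp
      | succ N hN ih =>
        rw [sum_Ico_succ_top hN, Nat.cast_succ]
        have := inv_mul_sqrt_le' (m := N) (hn.trans hN)
        linarith
    refine (key N hnN.le).trans ?_
    have : 0 ≤ 1 / Real.sqrt (N : ℝ) := by positivity
    rw [div_eq_mul_one_div 2]
    linarith

/-- Products of factors `≥ 1` over nested integer intervals with the same right end are monotone in the left end. [folklore] -/
theorem prod_Ico_le_prod_Ico_of_one_le {f : ℕ → ℝ} (hf1 : ∀ l, 1 ≤ f l) {a i : ℕ} (hai : a ≤ i) (n : ℕ) :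
    ∏ l ∈ Ico i n, f l ≤ ∏ l ∈ Ico a n, f l := by
  have hf0 : ∀ l, 0 ≤ f l := fun l => zero_le_one.trans (hf1 l)
  have hone : ∀ s : Finset ℕ, 1 ≤ ∏ l ∈ s, f l := fun s => by
    calc (1 : ℝ) = ∏ l ∈ s, (1 : ℝ) := prod_const_one.symm
      _ ≤ ∏ l ∈ s, f l := prod_le_prod (fun _ _ => zero_le_one) fun l _ => hf1 l
  rcases le_or_gt n i with hni | hin
  · rw [Ico_eq_empty_of_le hni, prod_empty]; exact hone _
  · rw [← prod_Ico_consecutive f hai hin.le]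
    calc ∏ l ∈ Ico i n, f l = 1 * ∏ l ∈ Ico i n, f l := (one_mul _).symm
      _ ≤ (∏ l ∈ Ico a i, f l) * ∏ l ∈ Ico i n, f l :=
          mul_le_mul_of_nonneg_right (hone _) (prod_nonneg fun l _ => hf0 l)

/-- **THE DOWNWARD CONTRACTION** (ANY functional with zeroth moment `M` and floor `b`): if two box solutions from one pin have
`|1∕h_i² − 1∕h′_i²| ≤ η` for every `i ≥ n`, then at EVERY scale `j`, `|1∕h_j² − 1∕h′_j²| ≤ η·Π_{l∈[j,n)} (1 + (M∕2)·c_{l+1}³)`,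
`c_i = (1∕gIR² + i·b)^{−1∕2}` — the memory transports the discrepancy downwards with a multiplicative loss only. [folklore] -/
theorem abs_disc_le_mul_prod_of_tail
    (hB : ∀ u u' : ℕ → ℝ, SeqBox γ u → SeqBox γ u' → ∀ D : ℝ, (∀ j, |u j - u' j| ≤ D) → |B u - B u'| ≤ M * D)
    (hM : 0 ≤ M) (hb : 0 < b) (hgIR : 0 < gIR) (hlo : ∀ u, SeqBox γ u → b ≤ B u)
    (hh : SeqBox γ h) (hh' : SeqBox γ h') (hf : MemFlow B gIR h) (hf' : MemFlow B gIR h') {n : ℕ} {η : ℝ}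
    (hη0 : 0 ≤ η) (htail : ∀ i, n ≤ i → |1 / h i ^ 2 - 1 / h' i ^ 2| ≤ η) :
    ∀ j, |1 / h j ^ 2 - 1 / h' j ^ 2|
      ≤ η * ∏ l ∈ Ico j n, (1 + M / 2 * (1 / Real.sqrt (1 / gIR ^ 2 + ((l : ℝ) + 1) * b)) ^ 3) := by
  set f : ℕ → ℝ := fun l => 1 + M / 2 * (1 / Real.sqrt (1 / gIR ^ 2 + ((l : ℝ) + 1) * b)) ^ 3 with hfdef
  have hf1 : ∀ l, 1 ≤ f l := fun l => by
    have : 0 ≤ M / 2 * (1 / Real.sqrt (1 / gIR ^ 2 + ((l : ℝ) + 1) * b)) ^ 3 := by positivity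
    simp only [hfdef]; linarith
  -- downward induction: the bound holds at every `j ≥ n − k`
  have key : ∀ k : ℕ, ∀ j, n - k ≤ j → |1 / h j ^ 2 - 1 / h' j ^ 2| ≤ η * ∏ l ∈ Ico j n, f l := by
    intro k
    induction k with
    | zero =>
      intro j hj
      rw [Nat.sub_zero] at hj
      rw [Ico_eq_empty_of_le hj, prod_empty, mul_one]
      exact htail j hj
    | succ k ih =>
      intro j hj
      by_cases hj' : n - k ≤ j
      · exact ih j hj'
      · have hjn : j < n := by omega
        have hj1 : n - k ≤ j + 1 := by omega
        -- bound above `j+1`, uniform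
        set P := ∏ l ∈ Ico (j + 1) n, f l with hP
        have hPge : ∀ i, j + 1 ≤ i → ∏ l ∈ Ico i n, f l ≤ P := fun i hi => prod_Ico_le_prod_Ico_of_one_le hf1 hi n
        have hP0 : 0 ≤ P := prod_nonneg fun l _ => (zero_le_one.trans (hf1 l))
        have habove : ∀ i, j + 1 ≤ i → |1 / h i ^ 2 - 1 / h' i ^ 2| ≤ η * P := fun i hi =>
          (ih i (by omega)).trans (mul_le_mul_of_nonneg_left (hPge i hi) hη0)
        -- the histories above `j+1` are `(c_{j+1}³∕2)·ηP`-close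
        set c := 1 / Real.sqrt (1 / gIR ^ 2 + ((j : ℝ) + 1) * b) with hc
        have hclose : ∀ i, |h (j + 1 + i) - h' (j + 1 + i)| ≤ c ^ 3 / 2 * (η * P) := by
          intro i
          have h1 := abs_sub_le_half_cube_disc hb hgIR hlo hh hh' hf hf' (j + 1 + i)
          have hci : (1 / Real.sqrt (1 / gIR ^ 2 + ((j + 1 + i : ℕ) : ℝ) * b)) ^ 3 ≤ c ^ 3 := by
            refine pow_le_pow_left₀ (by positivity) (one_div_sqrt_anti (by positivity) ?_) 3
            push_cast; nlinarith [(Nat.cast_nonneg i : (0 : ℝ) ≤ i)]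
          exact h1.trans (mul_le_mul (div_le_div_of_nonneg_right hci (by norm_num)) (habove _ (by omega))
            (abs_nonneg _) (by positivity))
        have hstep := abs_disc_succ_sub_le hB hh hh' hf hf' j hclose
        have hDj1 := habove (j + 1) le_rfl
        rw [prod_eq_prod_Ico_succ_bot hjn]
        -- |D j| ≤ |D (j+1)| + |D(j+1) − D j| ≤ ηP + M c³/2 ηP = η·(f j · P)
        have := abs_sub_abs_le_abs_sub (1 / h j ^ 2 - 1 / h' j ^ 2) (1 / h (j + 1) ^ 2 - 1 / h' (j + 1) ^ 2)
        rw [abs_sub_comm] at hstep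
        have e : η * (f j * P) = η * P + M * (c ^ 3 / 2 * (η * P)) := by simp only [hfdef, hc]; ring
        rw [e]
        linarith
  intro j
  exact key n j (by omega)

/-- The transport factor is uniformly bounded: `Π_{l∈[j,n)}(1 + (M∕2)c_{l+1}³) ≤ exp(3M∕(2b√b))`. [folklore] -/
theorem prod_le_exp (hb : 0 < b) (hM : 0 ≤ M) (gIR : ℝ) (j n : ℕ) :
    ∏ l ∈ Ico j n, (1 + M / 2 * (1 / Real.sqrt (1 / gIR ^ 2 + ((l : ℝ) + 1) * b)) ^ 3)
      ≤ Real.exp (3 * M / (2 * (b * Real.sqrt b))) := by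
  have h1 : ∀ l : ℕ, (1 : ℝ) ≤ 1 + M / 2 * (1 / Real.sqrt (1 / gIR ^ 2 + ((l : ℝ) + 1) * b)) ^ 3 := fun l => by
    have : 0 ≤ M / 2 * (1 / Real.sqrt (1 / gIR ^ 2 + ((l : ℝ) + 1) * b)) ^ 3 := by positivity
    linarith
  calc ∏ l ∈ Ico j n, (1 + M / 2 * (1 / Real.sqrt (1 / gIR ^ 2 + ((l : ℝ) + 1) * b)) ^ 3)
      ≤ ∏ l ∈ range n, (1 + M / 2 * (1 / Real.sqrt (1 / gIR ^ 2 + ((l : ℝ) + 1) * b)) ^ 3) := by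
        rw [range_eq_Ico]; exact prod_Ico_le_prod_Ico_of_one_le h1 (Nat.zero_le j) n
    _ ≤ ∏ l ∈ range n, Real.exp (M / 2 * (1 / Real.sqrt (1 / gIR ^ 2 + ((l : ℝ) + 1) * b)) ^ 3) :=
        prod_le_prod (fun l _ => zero_le_one.trans (h1 l)) fun l _ => by
          rw [add_comm]; exact Real.add_one_le_exp _
    _ = Real.exp (∑ l ∈ range n, M / 2 * (1 / Real.sqrt (1 / gIR ^ 2 + ((l : ℝ) + 1) * b)) ^ 3) :=
        (Real.exp_sum _ _).symm
    _ ≤ Real.exp (3 * M / (2 * (b * Real.sqrt b))) := Real.exp_le_exp.2 (sum_eps_le hb hM gIR n)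

/-- **NON-MERGING** (ANY zeroth-moment functional with floor): if the recursion variables of two box solutions from one pin are `η`-close
from some scale on, they are `C·η`-close at EVERY scale, `C = exp(3M∕(2b√b))`; so distinct solutions keep their recursion variables
uniformly apart all the way to the ultraviolet ((E38c)'s tent: `D_m = 3 − 3∕y²` constant). [folklore] -/
theorem abs_disc_le_C_mul_of_tail
    (hB : ∀ u u' : ℕ → ℝ, SeqBox γ u → SeqBox γ u' → ∀ D : ℝ, (∀ j, |u j - u' j| ≤ D) → |B u - B u'| ≤ M * D)
    (hM : 0 ≤ M) (hb : 0 < b) (hgIR : 0 < gIR) (hlo : ∀ u, SeqBox γ u → b ≤ B u)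
    (hh : SeqBox γ h) (hh' : SeqBox γ h') (hf : MemFlow B gIR h) (hf' : MemFlow B gIR h') {n : ℕ} {η : ℝ}
    (hη0 : 0 ≤ η) (htail : ∀ i, n ≤ i → |1 / h i ^ 2 - 1 / h' i ^ 2| ≤ η) (j : ℕ) :
    |1 / h j ^ 2 - 1 / h' j ^ 2| ≤ Real.exp (3 * M / (2 * (b * Real.sqrt b))) * η := by
  have := abs_disc_le_mul_prod_of_tail hB hM hb hgIR hlo hh hh' hf hf' hη0 htail j
  rw [mul_comm]
  exact this.trans (mul_le_mul_of_nonneg_left (prod_le_exp hb hM gIR j n) hη0)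

/-- **THE CAUCHY TAIL**: for `1 ≤ n ≤ j`, `|D_j − D_n| ≤ (M·K∕(b√b))∕√n`, `K = 10M³∕(b³√b)` — the increments beyond `n` are bounded by
`M·(c_{l+1}³∕2)·K`, a summable sequence. [folklore] -/
theorem abs_disc_sub_disc_le_tail
    (hB : ∀ u u' : ℕ → ℝ, SeqBox γ u → SeqBox γ u' → ∀ D : ℝ, (∀ j, |u j - u' j| ≤ D) → |B u - B u'| ≤ M * D)
    (hM : 0 ≤ M) (hb : 0 < b) (hgIR : 0 < gIR) (hlo : ∀ u, SeqBox γ u → b ≤ B u)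
    (hh : SeqBox γ h) (hh' : SeqBox γ h') (hf : MemFlow B gIR h) (hf' : MemFlow B gIR h') {n j : ℕ} (hn : 1 ≤ n)
    (hnj : n ≤ j) :
    |(1 / h j ^ 2 - 1 / h' j ^ 2) - (1 / h n ^ 2 - 1 / h' n ^ 2)|
      ≤ M * (10 * M ^ 3 / (b ^ 3 * Real.sqrt b)) / (b * Real.sqrt b) / Real.sqrt (n : ℝ) := by
  set K : ℝ := 10 * M ^ 3 / (b ^ 3 * Real.sqrt b) with hK
  have hK0 : 0 ≤ K := by positivity
  set Δ : ℕ → ℝ := fun l => (1 / h (l + 1) ^ 2 - 1 / h' (l + 1) ^ 2) - (1 / h l ^ 2 - 1 / h' l ^ 2) with hΔ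
  have e : (1 / h j ^ 2 - 1 / h' j ^ 2) - (1 / h n ^ 2 - 1 / h' n ^ 2) = ∑ l ∈ Ico n j, Δ l := by
    rw [sum_Ico_eq_sub _ hnj, sum_range_sub (fun l => 1 / h l ^ 2 - 1 / h' l ^ 2) j,
      sum_range_sub (fun l => 1 / h l ^ 2 - 1 / h' l ^ 2) n]
    ring
  have hstep : ∀ l, |Δ l| ≤ M * (K / (2 * (b * Real.sqrt b)) * (1 / (((l : ℝ) + 1) * Real.sqrt ((l : ℝ) + 1)))) := by
    intro l
    refine abs_disc_succ_sub_le hB hh hh' hf hf' l fun i => ?_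
    have h1 := abs_sub_le_half_cube_disc hb hgIR hlo hh hh' hf hf' (l + 1 + i)
    have h2 := abs_disc_le_K hB hM hb hgIR hlo hh hh' hf hf' (l + 1 + i)
    have hci : (1 / Real.sqrt (1 / gIR ^ 2 + ((l + 1 + i : ℕ) : ℝ) * b)) ^ 3
        ≤ 1 / (b * Real.sqrt b * (((l : ℝ) + 1) * Real.sqrt ((l : ℝ) + 1))) := by
      refine le_trans ?_ (inv_sqrt_cube_le hb gIR l)
      refine pow_le_pow_left₀ (by positivity) (one_div_sqrt_anti (by positivity) ?_) 3
      push_cast; nlinarith [(Nat.cast_nonneg i : (0 : ℝ) ≤ i)]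
    calc |h (l + 1 + i) - h' (l + 1 + i)|
        ≤ (1 / Real.sqrt (1 / gIR ^ 2 + ((l + 1 + i : ℕ) : ℝ) * b)) ^ 3 / 2 * |1 / h (l + 1 + i) ^ 2 - 1 / h' (l + 1 + i) ^ 2| := h1
      _ ≤ (1 / (b * Real.sqrt b * (((l : ℝ) + 1) * Real.sqrt ((l : ℝ) + 1)))) / 2 * K :=
          mul_le_mul (div_le_div_of_nonneg_right hci (by norm_num)) h2 (abs_nonneg _) (by positivity)
      _ = K / (2 * (b * Real.sqrt b)) * (1 / (((l : ℝ) + 1) * Real.sqrt ((l : ℝ) + 1))) := by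
          field_simp
  rw [e]
  calc |∑ l ∈ Ico n j, Δ l| ≤ ∑ l ∈ Ico n j, |Δ l| := abs_sum_le_sum_abs _ _
    _ ≤ ∑ l ∈ Ico n j, M * (K / (2 * (b * Real.sqrt b)) * (1 / (((l : ℝ) + 1) * Real.sqrt ((l : ℝ) + 1)))) :=
        sum_le_sum fun l _ => hstep l
    _ = M * (K / (2 * (b * Real.sqrt b))) * ∑ l ∈ Ico n j, 1 / (((l : ℝ) + 1) * Real.sqrt ((l : ℝ) + 1)) := by
        rw [mul_sum]; exact sum_congr rfl fun l _ => by ring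
    _ ≤ M * (K / (2 * (b * Real.sqrt b))) * (2 / Real.sqrt (n : ℝ)) :=
        mul_le_mul_of_nonneg_left (sum_Ico_inv_mul_sqrt_le' hn j) (by positivity)
    _ = M * K / (b * Real.sqrt b) / Real.sqrt (n : ℝ) := by
        field_simp

/-! ## §5 THE MONOTONE THEOREM: a non-decreasing functional with any zeroth moment and a floor has unique box solutions -/

/-- **MONOTONE MEMORY NEVER NEEDS SMALLNESS.**  `B` NON-DECREASING in the history (pointwise order on the box ]0,γ]^ℕ), with a zeroth
moment `M` of ANY size and a floor `b > 0`; pin `gIR ∈ ]0,γ]`.  Then two box solutions of the flow with memory from `gIR` COINCIDE — no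
concavity ((E41)), no flat bottom ((E42)), no range or size restriction.  The discrepancy of the recursion variables is bounded
(`abs_disc_le_K`) and Cauchy (`abs_disc_sub_disc_le_tail`); it cannot tend to `0` unless it vanishes identically (`abs_disc_le_C_mul_of_tail`);
so it is eventually SIGN-DEFINITE, and (E42)'s downward induction `eq_of_disc_tail_nonneg` finishes. [folklore] -/
theorem memFlow_unique_of_monotone_zm
    (hmono : ∀ u v : ℕ → ℝ, SeqBox γ u → SeqBox γ v → (∀ j, u j ≤ v j) → B u ≤ B v)
    (hB : ∀ u u' : ℕ → ℝ, SeqBox γ u → SeqBox γ u' → ∀ D : ℝ, (∀ j, |u j - u' j| ≤ D) → |B u - B u'| ≤ M * D)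
    (hM : 0 ≤ M) (hgIR : 0 < gIR) (hb : 0 < b) (hlo : ∀ u, SeqBox γ u → b ≤ B u)
    (hh : SeqBox γ h) (hh' : SeqBox γ h') (hf : MemFlow B gIR h) (hf' : MemFlow B gIR h') : h = h' := by
  by_contra hne
  obtain ⟨j₀, hj₀⟩ : ∃ j, h j ≠ h' j := Function.ne_iff.mp hne
  -- the discrepancy at j₀ is nonzero
  set D : ℕ → ℝ := fun j => 1 / h j ^ 2 - 1 / h' j ^ 2 with hD
  have hD0 : D j₀ ≠ 0 := by
    intro h0
    apply hj₀
    have h1 : 1 / h j₀ ^ 2 = 1 / h' j₀ ^ 2 := sub_eq_zero.1 h0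
    have h2 : h j₀ ^ 2 = h' j₀ ^ 2 := by
      have := congrArg (fun x : ℝ => 1 / x) h1
      simpa only [one_div_one_div] using this
    exact (pow_left_inj₀ (hh j₀).1.le (hh' j₀).1.le two_ne_zero).1 h2
  set δ : ℝ := |D j₀| with hδ
  have hδ0 : 0 < δ := abs_pos.2 hD0
  set C : ℝ := Real.exp (3 * M / (2 * (b * Real.sqrt b))) with hC
  have hC0 : 0 < C := Real.exp_pos _
  set T : ℝ := M * (10 * M ^ 3 / (b ^ 3 * Real.sqrt b)) / (b * Real.sqrt b) with hT
  have hT0 : 0 ≤ T := by positivity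
  -- a scale `n ≥ 1` beyond which the discrepancy moves by less than `δ∕(4C)`
  obtain ⟨n, hn⟩ : ∃ n : ℕ, (4 * C * T / δ) ^ 2 + 1 < n := exists_nat_gt _
  have hn1 : 1 ≤ n := by
    have : (0 : ℝ) < n := by nlinarith [sq_nonneg (4 * C * T / δ)]
    exact_mod_cast Nat.one_le_iff_ne_zero.2 (by rintro rfl; simp at this)
  have hsn : 4 * C * T / δ < Real.sqrt (n : ℝ) := by
    refine lt_of_lt_of_le ?_ (Real.sqrt_le_sqrt hn.le)
    rw [Real.lt_sqrt (by positivity)]; linarith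
  have hTn : 2 * (T / Real.sqrt (n : ℝ)) < δ / (2 * C) := by
    have hs0 : 0 < Real.sqrt (n : ℝ) := Real.sqrt_pos.2 (by exact_mod_cast hn1)
    rw [div_lt_iff₀ hδ0] at hsn
    · rw [mul_div_assoc', div_lt_div_iff₀ hs0 (by positivity)]
      nlinarith
  -- the tail cannot be uniformly below `δ∕(2C)` (non-merging)
  have hfar : ∃ i, n ≤ i ∧ δ / (2 * C) < |D i| := by
    by_contra hno
    have hno' : ∀ i, n ≤ i → |D i| ≤ δ / (2 * C) := fun i hi => not_lt.1 fun hlt => hno ⟨i, hi, hlt⟩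
    have := abs_disc_le_C_mul_of_tail hB hM hb hgIR hlo hh hh' hf hf' (by positivity) hno' j₀
    have e : C * (δ / (2 * C)) = δ / 2 := by field_simp
    rw [e] at this
    linarith [hδ.symm.le]
  obtain ⟨i, hni, hi⟩ := hfar
  -- every later discrepancy has the sign of `D i`
  have hclose : ∀ j, n ≤ j → |D j - D i| < |D i| := by
    intro j hj
    have h1 := abs_disc_sub_disc_le_tail hB hM hb hgIR hlo hh hh' hf hf' hn1 hj
    have h2 := abs_disc_sub_disc_le_tail hB hM hb hgIR hlo hh hh' hf hf' hn1 hni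
    calc |D j - D i| = |(D j - D n) - (D i - D n)| := by ring_nf
      _ ≤ |D j - D n| + |D i - D n| := abs_sub _ _
      _ ≤ T / Real.sqrt (n : ℝ) + T / Real.sqrt (n : ℝ) := add_le_add h1 h2
      _ = 2 * (T / Real.sqrt (n : ℝ)) := by ring
      _ < δ / (2 * C) := hTn
      _ < |D i| := hi
  rcases lt_or_gt_of_ne (show D i ≠ 0 from fun h0 => by rw [h0, abs_zero] at hi; linarith [div_pos hδ0 (by positivity : (0:ℝ) < 2 * C)]) with hneg | hpos
  · -- `D i < 0`: the tail of `D` is negative, so `h′, h` have a nonnegative tail discrepancy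
    have htail : ∀ j, n ≤ j → 0 ≤ 1 / h' j ^ 2 - 1 / h j ^ 2 := by
      intro j hj
      have := hclose j hj
      rw [abs_of_neg hneg] at this
      have := (abs_lt.1 this).2
      show 0 ≤ 1 / h' j ^ 2 - 1 / h j ^ 2
      have e : 1 / h' j ^ 2 - 1 / h j ^ 2 = -D j := by simp only [hD]; ring
      linarith
    exact hne (eq_of_disc_tail_nonneg hmono hh' hh hf' hf htail).symm
  · have htail : ∀ j, n ≤ j → 0 ≤ 1 / h j ^ 2 - 1 / h' j ^ 2 := by
      intro j hj
      have := hclose j hj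
      rw [abs_of_pos hpos] at this
      have := (abs_lt.1 this).1
      show 0 ≤ D j
      linarith
    exact hne (eq_of_disc_tail_nonneg hmono hh hh' hf hf' htail)

/-- **WELL-POSEDNESS FOR MONOTONE MEMORY OF ANY SIZE**: with (E39)'s existence, exactly one box solution from every pin — stated with an
existence witness to keep the import graph linear. [folklore] -/
theorem existsUnique_memFlow_of_monotone_zm
    (hmono : ∀ u v : ℕ → ℝ, SeqBox γ u → SeqBox γ v → (∀ j, u j ≤ v j) → B u ≤ B v)
    (hB : ∀ u u' : ℕ → ℝ, SeqBox γ u → SeqBox γ u' → ∀ D : ℝ, (∀ j, |u j - u' j| ≤ D) → |B u - B u'| ≤ M * D)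
    (hM : 0 ≤ M) (hgIR : 0 < gIR) (hb : 0 < b) (hlo : ∀ u, SeqBox γ u → b ≤ B u)
    (hex : ∃ h : ℕ → ℝ, SeqBox γ h ∧ MemFlow B gIR h) : ∃! h : ℕ → ℝ, SeqBox γ h ∧ MemFlow B gIR h := by
  obtain ⟨h, hh, hf⟩ := hex
  exact ⟨h, ⟨hh, hf⟩, fun h' hh' => memFlow_unique_of_monotone_zm hmono hB hM hgIR hb hlo hh'.1 hh hh'.2 hf⟩

end Summit.QuantumFields.BalabanUV.Beta.EriceRemainderEnclosureHistoryAutonomyMonotoneGeneral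

end
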